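import Summits.KontsevichZagierPeriods.KontsevichZagierPeriods.Theorems.RootDecompRelativeModAbsoluteCylLogSplitP40

/-! # `RootDecompRelativeModAbsoluteCylLogSplitP41` — part 16/27 of the mechanical ≤400-line split of `RungClosure.lean` (sha256 f909f334226f0fb5…)
Source: decomp-kz lens-3 g12 `RungClosure.lean` v9 (HOME/decomp-kz-lens-3/g12/, sha256 f909f334…; critic g4-52/g4-57/g5 CLEARED, «lander: split v9 --supports 30572»): BLOCK I (57 g11 monolith decls missing from P01–P25), BLOCK II/III (WildCertAssembly parts 1–6, 8–10: `Leaf.cellLocalWildCert`, `Leaf.cylKernelZeroLog_of_trees`), Parts 12–13 (`Leaf.regKernelPairDegOne_iff_circlePos_of_trees`), BLOCK G13 (Möbius engine, test §C decided).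
Split by census-1 g9 `gen/splitlean.py`: scopes re-opened with their `open`/`variable`/`set_option` context; mathematics and declaration order unchanged. -/

noncomputable section
open Set MeasureTheory Filter Topology
open scoped BigOperators
open Literature.NumberTheory.Transcendental Literature.ModelTheory.ExponentialFields
namespace Summit.KontsevichZagierPeriods.RootDecompRelativeModAbsolute.Rung30571.RegularisedLogLayer.CylLog.Leaf
section T3
variable {q : ℕ}

/-- The padded torus factor `x ↦ zW Z W i x ^ nᵢ` is `ℚ`-semialgebraic on the piece. -/
theorem isSemialgebraicFunOn_zW_pow {C : Set (Fin 1 → ℝ)} (hC : IsSemialgebraic ℚ C)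
    {κ : Fin q → (Fin 1 → ℝ) → ℝ} (hκ : ∀ i, IsSemialgebraicFunOn ℚ C (κ i)) (Z : Fin q → Bool)
    (n : Fin q → ℕ) (i : Fin q) :
    IsSemialgebraicFunOn ℚ C (fun x => zW Z (fun i x => 1 + κ i x) i x ^ n i) := by
  have h1 : IsSemialgebraicFunOn ℚ C (fun _ => (1:ℝ)) :=
    (isSemialgebraicFunOn_const_natCast hC 1).congr fun _ _ => by simp
  by_cases hZ : Z i = true
  · have h1κ : IsSemialgebraicFunOn ℚ C (fun x => 1 + κ i x) := h1.fun_add (hκ i)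
    exact (h1κ.fun_pow (n i)).congr fun x _ => by simp [zW, hZ]
  · exact h1.congr fun x _ => by simp [zW, hZ]

end T3
end Summit.KontsevichZagierPeriods.RootDecompRelativeModAbsolute.Rung30571.RegularisedLogLayer.CylLog.Leaf
end
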